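import Mathlib
import HarnessLib
import Summits.Ventures.LatticeQCDFlow.Exactness.NCMCGeneralSpaceGammaMethodConsistency
import Summits.Ventures.LatticeQCDFlow.Exactness.NCMCGeneralSpaceIntervalCoverage

/-!
# THE Γ-METHOD ERROR BAR IS ASYMPTOTICALLY EXACT under a Doeblin POWER, from EVERY initial law: `√N (x̄_N − πf)/√(2 Γ̂_N(0) τ̂_{N,W_N}) ⇒ N(0,1)` and `P_{μ₀}{|x̄_N − πf| ≤ z √(2 Γ̂_N(0) τ̂_{N,W_N}/N)} → N(0,1)([−z, z])`

HONEST FRAMING: exact (Metropolis-corrected) sampling algorithms for lattice gauge theory;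
figures of merit are autocorrelation/cost numbers at stated couplings and volumes; no
continuum-physics claim.

Venture `LatticeQCDFlow` (cell pub-lqcd), topic `Exactness`; FANOUT row 13 (`eng-snf`, GEN-20).
NEW WORK of the cell, not a published result; no definition is introduced; nothing is cited as a
fact (Slutsky's lemma and the portmanteau theorem from Mathlib; the studentized MCMC CLT with a
consistent lag-window variance estimator — e.g. Geyer 1992 §3, Flegal–Jones 2010 — NAMED ONLY).
GEN-19 typed the Markov-chain CLT under a Doeblin power from every initial law
(`NCMCGeneralSpaceDoeblinPowerCLT.tendstoInDistribution_timeAverage_of_nHit`: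
`(√N)⁻¹ Σ_{t<N} (f(X_t) − πf) ⇒ N(0, σ²_f)`) and the PLUG-IN COVERAGE LEMMA with an almost surely
convergent scale (`NCMCGeneralSpaceIntervalCoverage.tendsto_measure_abs_mul_le_of_clt`), concluding
that a reported interval is asymptotically conservative whenever the `τ̄` used dominates `τ_int`.  With
the consistency IN PROBABILITY of scorer A's Γ-method statistic `σ̂²_N = Γ̂_N(0) · 2 τ̂_{N,W_N} → σ²_f`
(`NCMCGeneralSpaceGammaMethodConsistency.lean`, deterministic windows `W_N → ∞`, `W_N³/N → 0`) THIS
FILE closes the loop: the coverage lemma with a scale converging in probability (Slutsky), a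
continuous-mapping step for convergence in probability (`v ↦ (√v)⁻¹` at `σ²_f > 0`, by the
subsequence characterisation `exists_seq_tendstoInMeasure_atTop_iff`), and THE STUDENTIZED CLT WITH
THE DATA-DRIVEN Γ-METHOD VARIANCE: `(√N)⁻¹ Σ_{t<N}(f(X_t) − πf) · (√σ̂²_N)⁻¹ ⇒ N(0,1)` from EVERY initial
law, so the interval `x̄_N ± z √(σ̂²_N/N) = x̄_N ± z √(2 τ̂_{N,W_N} Γ̂_N(0)/N)` that a seat prints has
asymptotic coverage EXACTLY `N(0,1)([−z, z])` — not merely `≥` it — for every exact sampler of the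
cell whose certificate is a Doeblin power and every bounded observable with `σ²_f > 0`.

## Content

* `tendstoInMeasure_comp_continuousAt` — `Y_n →ᴾ c`, `g` continuous at `c`, `g ∘ Y_n` measurable ⇒
  `g ∘ Y_n →ᴾ g c`.
* **`tendsto_measure_abs_mul_le_of_clt_of_tendstoInMeasure`** — PLUG-IN COVERAGE, SCALE IN PROBABILITY:
  `X_n ⇒ N(0, w)`, `B_n →ᴾ b` ⇒ `P{|X_n B_n| ≤ z} → gaussianReal 0 (b² w) (Icc (−z) z)`.
* `chain_invSqrt_gammaWindow_tendstoInMeasure_of_nHit` — `(√σ̂²_N)⁻¹ →ᴾ (√σ²_f)⁻¹` (`σ²_f > 0`).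
* **`tendstoInDistribution_studentized_timeAverage_of_nHit`** — THE STUDENTIZED CLT:
  `TendstoInDistribution (N ↦ (√N)⁻¹ Σ_{t<N}(f(X_t) − πf) · (√σ̂²_N)⁻¹) atTop id P_{μ₀} (gaussianReal 0 1)`.
* **`tendsto_measure_studentized_timeAverage_le_of_nHit`** — EXACT ASYMPTOTIC COVERAGE:
  `P_{μ₀}{|(√N)⁻¹ Σ_{t<N}(f(X_t) − πf) · (√σ̂²_N)⁻¹| ≤ z} → gaussianReal 0 1 (Icc (−z) z)` (`z > 0`);
  `…_of_minorised` — the one-step case `κ(z, ·) ≥ ε ν` (rows 8 / 9's certificate shape).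

NOT CLAIMED: the automatic window; finite-`N` coverage or Berry–Esseen rates; `σ²_f = 0` (degenerate
observables); unbounded observables; any number of ours.
-/

namespace Summit.Ventures.LatticeQCDFlow.Exactness.GeneralNCMC

open MeasureTheory ProbabilityTheory Set Filter Finset
open scoped ENNReal NNReal Topology

/-! ## §1 Two general lemmas: continuous mapping in probability; plug-in coverage -/

section General

variable {Ω₀ : Type*} [MeasurableSpace Ω₀] {P : Measure Ω₀} [IsProbabilityMeasure P]
  {Ω' : Type*} [MeasurableSpace Ω'] {P' : Measure Ω'} [IsProbabilityMeasure P']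

/-- **Continuous mapping for convergence in probability to a constant**: if `Y_n → c` in measure,
`g` is continuous at `c` and every `g ∘ Y_n` is measurable, then `g ∘ Y_n → g c` in measure. -/
theorem tendstoInMeasure_comp_continuousAt {Y : ℕ → Ω₀ → ℝ} {c : ℝ} {g : ℝ → ℝ}
    (hY : TendstoInMeasure P Y atTop (fun _ => c)) (hg : ContinuousAt g c)
    (hgY : ∀ n, Measurable fun x => g (Y n x)) :
    TendstoInMeasure P (fun n x => g (Y n x)) atTop (fun _ => g c) := by
  rw [exists_seq_tendstoInMeasure_atTop_iff (fun n => (hgY n).aestronglyMeasurable)]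
  intro ns hns
  obtain ⟨ns', hns', hae⟩ := (hY.comp hns.tendsto_atTop).exists_seq_tendsto_ae
  refine ⟨ns', hns', ?_⟩
  filter_upwards [hae] with x hx
  exact hg.tendsto.comp hx

/-- **PLUG-IN COVERAGE LEMMA, SCALE IN PROBABILITY.**  If `X_n ⇒ Y` with `Y ~ N(0, w)`, `B_n → b` in
measure (each `B_n` measurable), then for every `z > 0`:
`P{|X_n · B_n| ≤ z} → gaussianReal 0 (b² w) (Icc (−z) z)`. -/
theorem tendsto_measure_abs_mul_le_of_clt_of_tendstoInMeasure {X B : ℕ → Ω₀ → ℝ}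
    (hBm : ∀ n, Measurable (B n)) {w : ℝ≥0} {b : ℝ} {Y : Ω' → ℝ}
    (hY : HasLaw Y (gaussianReal 0 w) P')
    (hX : TendstoInDistribution X atTop Y (fun _ => P) P')
    (hB : TendstoInMeasure P B atTop (fun _ => b)) {z : ℝ} (hz : 0 < z) :
    Tendsto (fun n => P {x | |X n x * B n x| ≤ z}) atTop
      (𝓝 (gaussianReal 0 (NNReal.mk (b ^ 2) (sq_nonneg _) * w) (Icc (-z) z))) := by
  have hXB := hX.continuous_comp_prodMk_of_tendstoInMeasure_const
    (g := fun p : ℝ × ℝ => p.1 * p.2) (by fun_prop) hB (fun n => (hBm n).aemeasurable)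
  have hlaw : HasLaw (fun ω => Y ω * b) (gaussianReal 0 (NNReal.mk (b ^ 2) (sq_nonneg _) * w)) P' := by
    have h := gaussianReal_mul_const hY b
    rwa [mul_zero] at h
  have hnull : (P'.map fun ω => Y ω * b) (frontier (Icc (-z) z)) = 0 := by
    rw [hlaw.map_eq, frontier_Icc (by linarith : -z ≤ z)]
    by_cases hv : NNReal.mk (b ^ 2) (sq_nonneg _) * w = 0
    · rw [hv, gaussianReal_zero_var, Measure.dirac_apply' _ (by measurability)]
      rw [Set.indicator_of_notMem]
      simp only [Set.mem_insert_iff, Set.mem_singleton_iff, not_or]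
      constructor <;> intro h0 <;> linarith
    · haveI := nullSingletonClass_gaussianReal (μ := 0) hv
      exact (Set.toFinite {-z, z}).measure_zero _
  have key := ProbabilityMeasure.tendsto_measure_of_null_frontier_of_tendsto' hXB.tendsto
    (E := Icc (-z) z) (by simpa using hnull)
  simp only [ProbabilityMeasure.coe_mk] at key
  rw [hlaw.map_eq] at key
  refine key.congr fun n => ?_
  rw [Measure.map_apply_of_aemeasurable (hXB.forall_aemeasurable n) measurableSet_Icc]
  congr 1
  ext x
  simp only [Set.mem_preimage, Set.mem_Icc, mem_setOf_eq, abs_le]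

end General

/-! ## §2 The studentized chain CLT with the Γ-method variance -/

section Chain

variable {S : Type*} [MeasurableSpace S]
  {κ : Kernel S S} [IsMarkovKernel κ] {π : Measure S} [IsProbabilityMeasure π]
  {ν : Measure S} [IsProbabilityMeasure ν] {ε : ℝ≥0∞} {m : ℕ}

/-- The Γ-method statistic of `f ∘ X` is a measurable function of the path. -/
theorem measurable_gammaWindow {f : S → ℝ} (hf : Measurable f) (N W : ℕ) :
    Measurable fun x : ℕ → S => Scoring.gammaHat (fun i => f (x i)) N 0
      * (2 * Scoring.tauIntWindow (Scoring.rhoHat (fun i => f (x i)) N) W) := by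
  have h : (fun x : ℕ → S => Scoring.gammaHat (fun i => f (x i)) N 0
      * (2 * Scoring.tauIntWindow (Scoring.rhoHat (fun i => f (x i)) N) W))
      = fun x : ℕ → S => Scoring.gammaHat (fun i => f (x i)) N 0
        + 2 * ∑ t ∈ range W, Scoring.gammaHat (fun i => f (x i)) N (t + 1) := by
    funext x
    exact (gammaWindow_eq_gammaHat_mul_tauIntWindow (fun i => f (x i)) N W).symm
  rw [h]
  exact (measurable_gammaHat_comp hf N 0).add
    ((Finset.measurable_sum _ fun t _ => measurable_gammaHat_comp hf N (t + 1)).const_mul 2)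

/-- The Green–Kubo variance in the form of `NCMCGeneralSpaceDoeblinPowerCLT` is `C_f̄(0) + 2 Σ' C_f̄(t+1)`. -/
theorem cltVariance_eq_autocov (κ : Kernel S S) (π : Measure S) (f : S → ℝ) :
    (∫ y, (f y - ∫ z, f z ∂π) ^ 2 ∂π)
        + 2 * ∑' k, ∫ y, (f y - ∫ z, f z ∂π)
          * (Scoring.kop κ)^[k + 1] (fun y => f y - ∫ z, f z ∂π) y ∂π
      = Scoring.autocov κ π (fun y => f y - ∫ z, f z ∂π) 0
        + 2 * ∑' t, Scoring.autocov κ π (fun y => f y - ∫ z, f z ∂π) (t + 1) := by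
  unfold Scoring.autocov
  simp only [Function.iterate_zero, id_eq, sq]

variable (μ₀ : Measure S) [IsProbabilityMeasure μ₀]

/-- **The plug-in scale converges in probability**: for `σ²_f > 0` and windows `W_N → ∞`,
`W_N³/N → 0`: `(√(Γ̂_N(0) · 2 τ̂_{N,W_N}))⁻¹ → (√σ²_f)⁻¹` in `P_{μ₀}`-measure, every `μ₀`. -/
theorem chain_invSqrt_gammaWindow_tendstoInMeasure_of_nHit (hπ : Kernel.Invariant κ π)
    (hε : ε ≠ 0) (hmin : ∀ z, ε • ν ≤ nHit κ m z) (hm : 0 < m)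
    {f : S → ℝ} (hf : Measurable f) {C : ℝ} (hC : ∀ x, |f x| ≤ C)
    (hσ : 0 < Scoring.autocov κ π (fun y => f y - ∫ z, f z ∂π) 0
        + 2 * ∑' t, Scoring.autocov κ π (fun y => f y - ∫ z, f z ∂π) (t + 1))
    {W : ℕ → ℕ} (hW : Tendsto W atTop atTop) (hW3 : Tendsto (fun N => (W N : ℝ) ^ 3 / N) atTop (𝓝 0)) :
    TendstoInMeasure (Kernel.trajMeasure (X := fun _ : ℕ => S) μ₀
        (fun n : ℕ => κ.comap (fun h : (i : ↥(Finset.Iic n)) → S => h ⟨n, Finset.mem_Iic.2 le_rfl⟩)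
          (measurable_pi_apply _)))
      (fun (N : ℕ) (x : ℕ → S) => (Real.sqrt (Scoring.gammaHat (fun i => f (x i)) N 0
        * (2 * Scoring.tauIntWindow (Scoring.rhoHat (fun i => f (x i)) N) (W N))))⁻¹)
      atTop (fun _ => (Real.sqrt (Scoring.autocov κ π (fun y => f y - ∫ z, f z ∂π) 0
        + 2 * ∑' t, Scoring.autocov κ π (fun y => f y - ∫ z, f z ∂π) (t + 1)))⁻¹) := by
  haveI : Nonempty S := nonempty_of_isProbabilityMeasure μ₀
  have hε1 : ε ≤ 1 := by
    haveI := isMarkovKernel_nHit κ m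
    exact eps_le_one_of_minorised hmin
  have hcons := chain_gammaWindow_tendstoInMeasure_of_nHit μ₀
    (fun z B hB => minorised_setwise hmin z hB) (pos_iff_ne_zero.2 hε) hε1 hm hπ hf hC hW hW3
  have hsq : ContinuousAt (fun v : ℝ => (Real.sqrt v)⁻¹)
      (Scoring.autocov κ π (fun y => f y - ∫ z, f z ∂π) 0
        + 2 * ∑' t, Scoring.autocov κ π (fun y => f y - ∫ z, f z ∂π) (t + 1)) :=
    Real.continuous_sqrt.continuousAt.inv₀ (Real.sqrt_pos.2 hσ).ne'
  exact tendstoInMeasure_comp_continuousAt (g := fun v : ℝ => (Real.sqrt v)⁻¹) hcons hsq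
    (fun N => (measurable_gammaWindow hf N (W N)).sqrt.inv)

/-- **THE STUDENTIZED CHAIN CLT WITH THE Γ-METHOD VARIANCE, FROM EVERY INITIAL LAW.**  `κ` Markov,
`π` invariant, `(nHit κ m)(z, ·) ≥ ε ν` (`ε ≠ 0`, `0 < m`), `|f| ≤ C` measurable with `σ²_f > 0`;
windows `W_N → ∞`, `W_N³/N → 0`.  For EVERY initial law `μ₀`:
`(√N)⁻¹ Σ_{t<N} (f(X_t) − πf) · (√(Γ̂_N(0) · 2 τ̂_{N,W_N}))⁻¹ ⇒ N(0, 1)` (the canonical variable `id`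
on `(ℝ, gaussianReal 0 1)`). -/
theorem tendstoInDistribution_studentized_timeAverage_of_nHit (hπ : Kernel.Invariant κ π)
    (hε : ε ≠ 0) (hmin : ∀ z, ε • ν ≤ nHit κ m z) (hm : 0 < m)
    {f : S → ℝ} (hf : Measurable f) {C : ℝ} (hC : ∀ x, |f x| ≤ C)
    (hσ : 0 < Scoring.autocov κ π (fun y => f y - ∫ z, f z ∂π) 0
        + 2 * ∑' t, Scoring.autocov κ π (fun y => f y - ∫ z, f z ∂π) (t + 1))
    {W : ℕ → ℕ} (hW : Tendsto W atTop atTop) (hW3 : Tendsto (fun N => (W N : ℝ) ^ 3 / N) atTop (𝓝 0))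
    [IsProbabilityMeasure (Kernel.trajMeasure (X := fun _ : ℕ => S) μ₀
        (fun n : ℕ => κ.comap (fun hh : (i : ↥(Finset.Iic n)) → S => hh ⟨n, Finset.mem_Iic.2 le_rfl⟩)
          (measurable_pi_apply _)))] :
    TendstoInDistribution (fun (N : ℕ) (x : ℕ → S) =>
        ((Real.sqrt N)⁻¹ * ∑ t ∈ range N, (f (x t) - ∫ z, f z ∂π))
          * (Real.sqrt (Scoring.gammaHat (fun i => f (x i)) N 0
            * (2 * Scoring.tauIntWindow (Scoring.rhoHat (fun i => f (x i)) N) (W N))))⁻¹)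
      atTop id (fun _ => Kernel.trajMeasure (X := fun _ : ℕ => S) μ₀
        (fun n : ℕ => κ.comap (fun hh : (i : ↥(Finset.Iic n)) → S => hh ⟨n, Finset.mem_Iic.2 le_rfl⟩)
          (measurable_pi_apply _))) (gaussianReal 0 1) := by
  set σ2 := Scoring.autocov κ π (fun y => f y - ∫ z, f z ∂π) 0
    + 2 * ∑' t, Scoring.autocov κ π (fun y => f y - ∫ z, f z ∂π) (t + 1) with hσ2
  -- the CLT with the canonical Gaussian variable of variance `σ²_f`
  have hclt := tendstoInDistribution_timeAverage_of_nHit hπ hε hmin hm hf hC μ₀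
    (P' := gaussianReal 0 (Real.toNNReal ((∫ y, (f y - ∫ z, f z ∂π) ^ 2 ∂π)
      + 2 * ∑' k, ∫ y, (f y - ∫ z, f z ∂π)
        * (Scoring.kop κ)^[k + 1] (fun y => f y - ∫ z, f z ∂π) y ∂π))) (Y := id) HasLaw.id
  rw [cltVariance_eq_autocov κ π f] at hclt
  -- the plug-in scale
  have hB := chain_invSqrt_gammaWindow_tendstoInMeasure_of_nHit μ₀ hπ hε hmin hm hf hC hσ hW hW3
  have hBm : ∀ N, Measurable fun x : ℕ → S => (Real.sqrt (Scoring.gammaHat (fun i => f (x i)) N 0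
      * (2 * Scoring.tauIntWindow (Scoring.rhoHat (fun i => f (x i)) N) (W N))))⁻¹ := fun N =>
    (measurable_gammaWindow hf N (W N)).sqrt.inv
  have hXB := hclt.continuous_comp_prodMk_of_tendstoInMeasure_const
    (g := fun p : ℝ × ℝ => p.1 * p.2) (by fun_prop) hB (fun N => (hBm N).aemeasurable)
  -- identify the limit law `N(0, σ²) scaled by (√σ²)⁻¹` with `N(0, 1)`
  have hb2 : NNReal.mk (((Real.sqrt σ2)⁻¹) ^ 2) (sq_nonneg _) * σ2.toNNReal = 1 := by
    apply NNReal.eq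
    rw [NNReal.coe_mul, NNReal.coe_mk, Real.coe_toNNReal _ hσ.le, NNReal.coe_one, inv_pow,
      Real.sq_sqrt hσ.le, inv_mul_cancel₀ hσ.ne']
  have hlaw : HasLaw (fun ω : ℝ => id ω * (Real.sqrt σ2)⁻¹) (gaussianReal 0 1)
      (gaussianReal 0 σ2.toNNReal) := by
    have h := gaussianReal_mul_const (HasLaw.id (μ := gaussianReal 0 σ2.toNNReal)) (Real.sqrt σ2)⁻¹
    rwa [mul_zero, hb2] at h
  refine ⟨hXB.forall_aemeasurable, aemeasurable_id, ?_⟩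
  have ht := hXB.tendsto
  have heq : (⟨(gaussianReal 0 1).map id, Measure.isProbabilityMeasure_map aemeasurable_id⟩ :
      ProbabilityMeasure ℝ)
      = ⟨(gaussianReal 0 σ2.toNNReal).map (fun ω : ℝ => id ω * (Real.sqrt σ2)⁻¹),
        Measure.isProbabilityMeasure_map hXB.aemeasurable_limit⟩ := by
    apply Subtype.ext
    show (gaussianReal 0 1).map id = (gaussianReal 0 σ2.toNNReal).map (fun ω : ℝ => id ω * (Real.sqrt σ2)⁻¹)
    rw [Measure.map_id, hlaw.map_eq]
  rw [heq]
  exact ht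

/-- **THE Γ-METHOD ERROR BAR HAS ASYMPTOTICALLY EXACT COVERAGE, FROM EVERY INITIAL LAW.**  Under the
hypotheses of `tendstoInDistribution_studentized_timeAverage_of_nHit`, for every `z > 0`:
`P_{μ₀}{|(√N)⁻¹ Σ_{t<N} (f(X_t) − πf) · (√(Γ̂_N(0) · 2 τ̂_{N,W_N}))⁻¹| ≤ z} → gaussianReal 0 1 (Icc (−z) z)`
— the interval `x̄_N ± z √(2 τ̂_{N,W_N} Γ̂_N(0)/N)` covers `πf` with probability tending to the nominal
Gaussian level. -/
theorem tendsto_measure_studentized_timeAverage_le_of_nHit (hπ : Kernel.Invariant κ π)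
    (hε : ε ≠ 0) (hmin : ∀ z, ε • ν ≤ nHit κ m z) (hm : 0 < m)
    {f : S → ℝ} (hf : Measurable f) {C : ℝ} (hC : ∀ x, |f x| ≤ C)
    (hσ : 0 < Scoring.autocov κ π (fun y => f y - ∫ z, f z ∂π) 0
        + 2 * ∑' t, Scoring.autocov κ π (fun y => f y - ∫ z, f z ∂π) (t + 1))
    {W : ℕ → ℕ} (hW : Tendsto W atTop atTop) (hW3 : Tendsto (fun N => (W N : ℝ) ^ 3 / N) atTop (𝓝 0))
    {z : ℝ} (hz : 0 < z)
    [IsProbabilityMeasure (Kernel.trajMeasure (X := fun _ : ℕ => S) μ₀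
        (fun n : ℕ => κ.comap (fun hh : (i : ↥(Finset.Iic n)) → S => hh ⟨n, Finset.mem_Iic.2 le_rfl⟩)
          (measurable_pi_apply _)))] :
    Tendsto (fun N : ℕ => (Kernel.trajMeasure (X := fun _ : ℕ => S) μ₀
        (fun n : ℕ => κ.comap (fun hh : (i : ↥(Finset.Iic n)) → S => hh ⟨n, Finset.mem_Iic.2 le_rfl⟩)
          (measurable_pi_apply _)))
        {x : ℕ → S | |((Real.sqrt N)⁻¹ * ∑ t ∈ range N, (f (x t) - ∫ z, f z ∂π))
          * (Real.sqrt (Scoring.gammaHat (fun i => f (x i)) N 0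
            * (2 * Scoring.tauIntWindow (Scoring.rhoHat (fun i => f (x i)) N) (W N))))⁻¹| ≤ z})
      atTop (𝓝 (gaussianReal 0 1 (Icc (-z) z))) := by
  set σ2 := Scoring.autocov κ π (fun y => f y - ∫ z, f z ∂π) 0
    + 2 * ∑' t, Scoring.autocov κ π (fun y => f y - ∫ z, f z ∂π) (t + 1) with hσ2
  have hclt := tendstoInDistribution_timeAverage_of_nHit hπ hε hmin hm hf hC μ₀
    (P' := gaussianReal 0 (Real.toNNReal ((∫ y, (f y - ∫ z, f z ∂π) ^ 2 ∂π)
      + 2 * ∑' k, ∫ y, (f y - ∫ z, f z ∂π)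
        * (Scoring.kop κ)^[k + 1] (fun y => f y - ∫ z, f z ∂π) y ∂π))) (Y := id) HasLaw.id
  rw [cltVariance_eq_autocov κ π f] at hclt
  have hB := chain_invSqrt_gammaWindow_tendstoInMeasure_of_nHit μ₀ hπ hε hmin hm hf hC hσ hW hW3
  have hBm : ∀ N, Measurable fun x : ℕ → S => (Real.sqrt (Scoring.gammaHat (fun i => f (x i)) N 0
      * (2 * Scoring.tauIntWindow (Scoring.rhoHat (fun i => f (x i)) N) (W N))))⁻¹ := fun N =>
    (measurable_gammaWindow hf N (W N)).sqrt.inv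
  have h := tendsto_measure_abs_mul_le_of_clt_of_tendstoInMeasure hBm HasLaw.id hclt hB hz
  have hb2 : NNReal.mk (((Real.sqrt σ2)⁻¹) ^ 2) (sq_nonneg _) * σ2.toNNReal = 1 := by
    apply NNReal.eq
    rw [NNReal.coe_mul, NNReal.coe_mk, Real.coe_toNNReal _ hσ.le, NNReal.coe_one, inv_pow,
      Real.sq_sqrt hσ.le, inv_mul_cancel₀ hσ.ne']
  rw [hb2] at h
  exact h

/-- **One-step minorisation** (`κ(z, ·) ≥ ε ν`, the certificate shape of rows 8 / 9's samplers and
of row 8's `Scoring.markovChain_clt`): the same exact asymptotic coverage, `m = 1`. -/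
theorem tendsto_measure_studentized_timeAverage_le_of_minorised (hπ : Kernel.Invariant κ π)
    (hε : ε ≠ 0) (hmin : ∀ z, ε • ν ≤ κ z)
    {f : S → ℝ} (hf : Measurable f) {C : ℝ} (hC : ∀ x, |f x| ≤ C)
    (hσ : 0 < Scoring.autocov κ π (fun y => f y - ∫ z, f z ∂π) 0
        + 2 * ∑' t, Scoring.autocov κ π (fun y => f y - ∫ z, f z ∂π) (t + 1))
    {W : ℕ → ℕ} (hW : Tendsto W atTop atTop) (hW3 : Tendsto (fun N => (W N : ℝ) ^ 3 / N) atTop (𝓝 0))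
    {z : ℝ} (hz : 0 < z)
    [IsProbabilityMeasure (Kernel.trajMeasure (X := fun _ : ℕ => S) μ₀
        (fun n : ℕ => κ.comap (fun hh : (i : ↥(Finset.Iic n)) → S => hh ⟨n, Finset.mem_Iic.2 le_rfl⟩)
          (measurable_pi_apply _)))] :
    Tendsto (fun N : ℕ => (Kernel.trajMeasure (X := fun _ : ℕ => S) μ₀
        (fun n : ℕ => κ.comap (fun hh : (i : ↥(Finset.Iic n)) → S => hh ⟨n, Finset.mem_Iic.2 le_rfl⟩)
          (measurable_pi_apply _)))
        {x : ℕ → S | |((Real.sqrt N)⁻¹ * ∑ t ∈ range N, (f (x t) - ∫ z, f z ∂π))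
          * (Real.sqrt (Scoring.gammaHat (fun i => f (x i)) N 0
            * (2 * Scoring.tauIntWindow (Scoring.rhoHat (fun i => f (x i)) N) (W N))))⁻¹| ≤ z})
      atTop (𝓝 (gaussianReal 0 1 (Icc (-z) z))) := by
  have hmin' : ∀ z, ε • ν ≤ nHit κ 1 z := fun z => by rw [nHit_one]; exact hmin z
  exact tendsto_measure_studentized_timeAverage_le_of_nHit μ₀ hπ hε hmin' Nat.one_pos hf hC hσ hW
    hW3 hz

end Chain

end Summit.Ventures.LatticeQCDFlow.Exactness.GeneralNCMC
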